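import Literature.NumberTheory.EllipticCurves.HeckeOperatorsProofs
import Mathlib.NumberTheory.ModularForms.Cusps
import HarnessLib

/-!
# Cusp classes of `Γ₀(M)`: the orbit criterion on `P¹(ℚ)` in bottom-row coordinates, and its calculus

Summit `BirchSwinnertonDyer`, route `ManinLocalTwoThree` (cell bsd-f2-manin), cruxes C2 `ManinOddAtFour`
(stmt-BirchSwinnertonDyer-22967) / C3 `ManinPrimeToThreeAtNine` (stmt-BirchSwinnertonDyer-22968).  Second file of the
cusp-symbol layer of the relative-Ihara proof (MEMO-es §22–§23; first file
`Theorems/ManinLocalTwoThreeCuspSymbolBoundary.lean`).  Its target is E-es-30 `BoundaryEisenstein` («the cusp module of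
`Γ₀(M)` is Eisenstein», MEMO-es §22.3), whose proof needs the structure of the finite set `Γ₀(M)\P¹(ℚ)` of cusps.
Instead of the classical list `(d ∣ M, u ∈ (ℤ/gcd(d,M/d))^×/±1)` (Diamond–Shurman §3.8) we use BOTTOM-ROW COORDINATES:
every cusp is `g∞` for some `g ∈ SL₂(ℤ)` (Mathlib `OnePoint.exists_mem_SL2`), and for `g = (a b; c d)`,
`g' = (a' b'; c' d')`:

  `Γ₀(M) g ∞ = Γ₀(M) g' ∞  ⟺  ∃ k, M ∣ c'(d + k c) − d' c`       (`exists_gamma0_smul_eq_of_cuspRel`, `cuspRel_of_gamma0_smul_eq`)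

(`⟸`: `γ = g' (g T^k)⁻¹` has lower-left entry `c'(d+kc) − d'c`; `⟹`: `g'⁻¹ γ g` fixes `∞`, so it is `±T^k`).  The
relation `R_M((c,d),(c',d')) :⟺ ∃ k, M ∣ c'(d + kc) − d'c` («`c'd − d'c ∈ (cc', M)`») is written INLINE throughout (no
definition); this file proves its calculus: reflexive, symmetric, transitive through any middle pair that is primitive
mod `M` (`cuspRel_trans`), invariant under `d ↦ d + kc`, under scaling, under `(c,d) ↦ (c, r d)` (any `r`) and
`(c,d) ↦ (r c, d)` (`r` a unit mod `M`), together with the primitivity witnesses for bottom rows of `SL₂(ℤ)` and their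
`r`-modifications, and the consequence used downstream: a `Γ₀(M)`-invariant function on `P¹(ℚ)` takes the same value at
`g∞` and `g'∞` whenever the bottom rows are related (`cuspFun_eq_of_cuspRel`).  In these coordinates the Hecke
operator `T_r` (`r ∤ M`) on `Γ₀(M)`-invariant functions reads `[(c,d)] ↦ [(c, r d)] + r·[(r c, d)]` (next file), which is
what makes the cusp module Eisenstein.

Everything is elementary `2 × 2` arithmetic over `ℤ`; no new definitions; nothing about BSD or Manin's conjecture is
proved here.

References: F. Diamond, J. Shurman, *A first course in modular forms*, GTM 228, Prop. 3.8.3 (cusps of `Γ₀(N)`);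
G. Shimura, *Introduction to the arithmetic theory of automorphic functions* (1971) §1.6 (cusps as `Γ\SL₂(ℤ)/Γ_∞`);
cell memo HOME/MEMO-es.md §22.3.
-/

set_option autoImplicit false
set_option linter.dupNamespace false

open scoped MatrixGroups

open CongruenceSubgroup Matrix.SpecialLinearGroup Literature.NumberTheory.EllipticCurves.ModularForms

namespace Summit.BirchSwinnertonDyer.BirchSwinnertonDyer.Theorems.ManinLocalTwoThree

/-! ### §1  The calculus of the relation `∃ k, M ∣ c'(d + k c) − d' c` -/

section Rel

variable (M : ℤ)

/-- Reflexivity: `(c,d) ~ (c,d)` (take `k = 0`). [folklore] -/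
theorem cuspRel_refl (c d : ℤ) : ∃ k : ℤ, M ∣ c * (d + k * c) - d * c :=
  ⟨0, ⟨0, by ring⟩⟩

/-- Symmetry: `(c,d) ~ (c',d') ⟹ (c',d') ~ (c,d)` (replace `k` by `−k`). [folklore] -/
theorem cuspRel_symm {c d c' d' : ℤ} (h : ∃ k : ℤ, M ∣ c' * (d + k * c) - d' * c) :
    ∃ k : ℤ, M ∣ c * (d' + k * c') - d * c' := by
  obtain ⟨k, m, hm⟩ := h
  exact ⟨-k, -m, by linear_combination -hm⟩

/-- **Transitivity through a pair primitive mod `M`**: if `(c₁,d₁) ~ (c₂,d₂)`, `(c₂,d₂) ~ (c₃,d₃)` and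
`α c₂ + β d₂ + μ M = 1` for some integers, then `(c₁,d₁) ~ (c₃,d₃)`.  (With `X = c₃d₁ − c₁d₃`: both `c₂ X` and `d₂ X`
lie in `(c₁c₃, M)`, hence so does `X = (αc₂ + βd₂ + μM) X`.)  Primitivity of the middle pair cannot be dropped. [folklore] -/
theorem cuspRel_trans {c₁ d₁ c₂ d₂ c₃ d₃ : ℤ} (hprim : ∃ α β μ : ℤ, α * c₂ + β * d₂ + μ * M = 1)
    (h₁ : ∃ k : ℤ, M ∣ c₂ * (d₁ + k * c₁) - d₂ * c₁) (h₂ : ∃ k : ℤ, M ∣ c₃ * (d₂ + k * c₂) - d₃ * c₂) :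
    ∃ k : ℤ, M ∣ c₃ * (d₁ + k * c₁) - d₃ * c₁ := by
  obtain ⟨α, β, μ, hp⟩ := hprim
  obtain ⟨k₁, m₁, hm₁⟩ := h₁
  obtain ⟨k₂, m₂, hm₂⟩ := h₂
  refine ⟨k₁ + k₂, α * (c₃ * m₁ + c₁ * m₂) + β * (m₂ * d₁ + m₁ * d₃ - k₂ * c₃ * m₁ + k₁ * c₁ * m₂)
    + μ * (c₃ * d₁ - d₃ * c₁) + (k₁ + k₂) * c₁ * c₃ * μ, ?_⟩
  linear_combination (α * c₃ + β * d₃ - β * k₂ * c₃) * hm₁ + (α * c₁ + β * d₁ + β * k₁ * c₁) * hm₂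
    - (c₃ * d₁ - d₃ * c₁ + (k₁ + k₂) * c₁ * c₃) * hp

/-- Translation: `(c,d) ~ (c, d + j c)`. [folklore] -/
theorem cuspRel_translate (c d j : ℤ) : ∃ k : ℤ, M ∣ c * (d + k * c) - (d + j * c) * c :=
  ⟨j, 0, by ring⟩

/-- Scaling: `(c,d) ~ (u c, u d)` for every `u` (only useful when `u` is a unit mod `M`). [folklore] -/
theorem cuspRel_scale (c d u : ℤ) : ∃ k : ℤ, M ∣ (u * c) * (d + k * c) - (u * d) * c :=
  ⟨0, 0, by ring⟩

/-- The relation is preserved by `(c,d) ↦ (c, r d)` for every integer `r`. [folklore] -/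
theorem cuspRel_mul_right {c d c' d' : ℤ} (r : ℤ) (h : ∃ k : ℤ, M ∣ c' * (d + k * c) - d' * c) :
    ∃ k : ℤ, M ∣ c' * (r * d + k * c) - (r * d') * c := by
  obtain ⟨k, m, hm⟩ := h
  exact ⟨r * k, r * m, by linear_combination r * hm⟩

/-- The relation is preserved by `(c,d) ↦ (r c, d)` for every `r` invertible mod `M` (`s r + t M = 1`). [folklore] -/
theorem cuspRel_mul_left {c d c' d' : ℤ} {r s t : ℤ} (hr : s * r + t * M = 1)
    (h : ∃ k : ℤ, M ∣ c' * (d + k * c) - d' * c) :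
    ∃ k : ℤ, M ∣ (r * c') * (d + k * (r * c)) - d' * (r * c) := by
  obtain ⟨k, m, hm⟩ := h
  exact ⟨k * s, r * m - c * c' * r * k * t, by linear_combination r * hm + c * c' * r * k * hr⟩

/-- `(e, d) ~ (r e, r d)`: the bottom row `(c/r, d)` lies in the class of `(c, r d)` (`c = r e`). [folklore] -/
theorem cuspRel_div_left (e d r : ℤ) : ∃ k : ℤ, M ∣ (r * e) * (d + k * e) - (r * d) * e :=
  cuspRel_scale M e d r

/-- `(c, e) ~ (r c, d)` when `r e = d − j c` and `r` is a unit mod `M`: the bottom row `(c, (d − jc)/r)` lies in the class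
of `(r c, d)`. [folklore] -/
theorem cuspRel_of_mul_eq_sub {c d e r j s t : ℤ} (hr : s * r + t * M = 1) (he : r * e = d - j * c) :
    ∃ k : ℤ, M ∣ (r * c) * (e + k * c) - d * c :=
  ⟨j * s, -(c * c * j * t), by linear_combination c * he + c * c * j * hr⟩

/-- `(r c, d − j c) ~ (r c, d)` when `r` is a unit mod `M`. [folklore] -/
theorem cuspRel_mul_left_sub {c d r j s t : ℤ} (hr : s * r + t * M = 1) :
    ∃ k : ℤ, M ∣ (r * c) * ((d - j * c) + k * (r * c)) - d * (r * c) :=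
  ⟨j * s, -(r * c * c * j * t), by linear_combination (r * c * c * j) * hr⟩

/-- Primitivity of `(c, r d)` mod `M` from `a d − b c = 1` and `r` a unit mod `M`. [folklore] -/
theorem primitive_mul_right {a b c d r s t : ℤ} (hdet : a * d - b * c = 1) (hr : s * r + t * M = 1) :
    ∃ α β μ : ℤ, α * c + β * (r * d) + μ * M = 1 :=
  ⟨-b, a * s, a * d * t, by linear_combination hdet + a * d * hr⟩

/-- Primitivity of `(r c, d)` mod `M` from `a d − b c = 1` and `r` a unit mod `M`. [folklore] -/
theorem primitive_mul_left {a b c d r s t : ℤ} (hdet : a * d - b * c = 1) (hr : s * r + t * M = 1) :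
    ∃ α β μ : ℤ, α * (r * c) + β * d + μ * M = 1 :=
  ⟨-(b * s), a, -(b * c * t), by linear_combination hdet - b * c * hr⟩

end Rel

/-! ### §2  Bottom rows of `SL₂(ℤ)` and the Möbius action on `∞` (plumbing) -/

section SL

/-- Entries of `mapGL ℚ g` are the rational images of the entries of `g`. [folklore] -/
theorem mapGL_rat_apply (g : SL(2, ℤ)) (i j : Fin 2) :
    (mapGL ℚ g : GL (Fin 2) ℚ) i j = ((g i j : ℤ) : ℚ) := by
  simp [Matrix.SpecialLinearGroup.mapGL_coe_matrix]

/-- The bottom row of `g ∈ SL₂(ℤ)` is primitive mod every `M`: `(−b) c + a d + 0·M = 1`. [folklore] -/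
theorem sl_bottom_primitive (M : ℤ) (g : SL(2, ℤ)) : ∃ α β μ : ℤ, α * g 1 0 + β * g 1 1 + μ * M = 1 :=
  ⟨-(g 0 1), g 0 0, 0, by linear_combination det_entries g⟩

/-- `g ∞ = ∞` iff the lower-left entry of `g ∈ SL₂(ℤ)` vanishes. [folklore] -/
theorem mapGL_smul_infty_eq_self_iff (g : SL(2, ℤ)) :
    (mapGL ℚ g : GL (Fin 2) ℚ) • (OnePoint.infty : OnePoint ℚ) = OnePoint.infty ↔ g 1 0 = 0 := by
  rw [OnePoint.smul_infty_eq_self_iff, mapGL_rat_apply]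
  exact_mod_cast Iff.rfl

/-- An element of `SL₂(ℤ)` with vanishing lower-left entry is `± T^k`: its diagonal entries are equal and square to `1`.
[folklore] -/
theorem sl_diag_of_apply_one_zero (δ : SL(2, ℤ)) (h : δ 1 0 = 0) :
    δ 0 0 = δ 1 1 ∧ δ 0 0 * δ 1 1 = 1 := by
  have hdet := det_entries δ
  rw [h, mul_zero, sub_zero] at hdet
  rcases Int.eq_one_or_neg_one_of_mul_eq_one' hdet with ⟨h0, h1⟩ | ⟨h0, h1⟩ <;>
    exact ⟨by rw [h0, h1], hdet⟩

end SL

/-! ### §3  The orbit criterion -/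

section Orbit

variable (M : ℕ)

/-- **Orbit criterion, sufficiency.**  If the bottom rows of `g, g' ∈ SL₂(ℤ)` satisfy `M ∣ c'(d + kc) − d'c` for
some `k`, then `g'∞ ∈ Γ₀(M) g∞`: indeed `γ := g' (g T^k)⁻¹` has lower-left entry `c'(d+kc) − d'c ≡ 0`, and
`γ g ∞ = g' T^{-k} ∞ = g'∞`. [folklore] -/
theorem exists_gamma0_smul_eq_of_cuspRel (g g' : SL(2, ℤ))
    (h : ∃ k : ℤ, (M : ℤ) ∣ g' 1 0 * (g 1 1 + k * g 1 0) - g' 1 1 * g 1 0) :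
    ∃ γ : Gamma0 M, (mapGL ℚ (γ : SL(2, ℤ)) : GL (Fin 2) ℚ) • (mapGL ℚ g : GL (Fin 2) ℚ) • (OnePoint.infty : OnePoint ℚ)
      = (mapGL ℚ g' : GL (Fin 2) ℚ) • OnePoint.infty := by
  obtain ⟨k, hk⟩ := h
  let Tk : SL(2, ℤ) := ⟨!![1, k; 0, 1], by rw [Matrix.det_fin_two_of]; ring⟩
  let γ₀ : SL(2, ℤ) := g' * (g * Tk)⁻¹
  have hentry : γ₀ 1 0 = g' 1 0 * (g 1 1 + k * g 1 0) - g' 1 1 * g 1 0 := by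
    simp [γ₀, Tk, Matrix.SpecialLinearGroup.coe_inv, Matrix.adjugate_fin_two, Matrix.mul_apply,
      Fin.sum_univ_two]
    ring
  have hγ₀ : γ₀ ∈ Gamma0 M := by
    rw [Gamma0_mem]
    have h' : ((γ₀ 1 0 : ℤ) : ZMod M) = 0 := by
      rw [hentry]
      exact (ZMod.intCast_zmod_eq_zero_iff_dvd _ M).mpr hk
    exact h'
  refine ⟨⟨γ₀, hγ₀⟩, ?_⟩
  have hprod : γ₀ * g = g' * Tk⁻¹ := by
    simp only [γ₀, mul_inv_rev, mul_assoc, inv_mul_cancel, mul_one]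
  have hT : (mapGL ℚ Tk⁻¹ : GL (Fin 2) ℚ) • (OnePoint.infty : OnePoint ℚ) = OnePoint.infty := by
    rw [mapGL_smul_infty_eq_self_iff]
    simp [Tk, Matrix.SpecialLinearGroup.coe_inv, Matrix.adjugate_fin_two]
  show (mapGL ℚ γ₀ : GL (Fin 2) ℚ) • (mapGL ℚ g : GL (Fin 2) ℚ) • (OnePoint.infty : OnePoint ℚ) = _
  rw [← mul_smul, ← map_mul, hprod, map_mul, mul_smul, hT]

/-- **Orbit criterion, necessity.**  If `γ g ∞ = g' ∞` for some `γ ∈ Γ₀(M)`, then the bottom rows satisfy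
`M ∣ c'(d + kc) − d'c` for some `k`: `δ := g'⁻¹ γ g` fixes `∞`, so `δ = ±T^{j}`, and the lower-left entry of
`γ = g' δ g⁻¹` is `±(c'd − d'c) − δ₀₁ c c'`. [folklore] -/
theorem cuspRel_of_gamma0_smul_eq (g g' : SL(2, ℤ)) (γ : Gamma0 M)
    (h : (mapGL ℚ (γ : SL(2, ℤ)) : GL (Fin 2) ℚ) • (mapGL ℚ g : GL (Fin 2) ℚ) • (OnePoint.infty : OnePoint ℚ)
      = (mapGL ℚ g' : GL (Fin 2) ℚ) • OnePoint.infty) :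
    ∃ k : ℤ, (M : ℤ) ∣ g' 1 0 * (g 1 1 + k * g 1 0) - g' 1 1 * g 1 0 := by
  set δ : SL(2, ℤ) := g'⁻¹ * ((γ : SL(2, ℤ)) * g) with hδ
  have hfix : (mapGL ℚ δ : GL (Fin 2) ℚ) • (OnePoint.infty : OnePoint ℚ) = OnePoint.infty := by
    rw [hδ, map_mul, map_mul, mul_smul, mul_smul, h, ← mul_smul, ← map_mul, inv_mul_cancel, map_one, one_smul]
  have h10 : δ 1 0 = 0 := (mapGL_smul_infty_eq_self_iff δ).mp hfix
  obtain ⟨hdiag, hunit⟩ := sl_diag_of_apply_one_zero δ h10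
  -- `γ = g' δ g⁻¹`
  have hγ : ((γ : SL(2, ℤ)) : SL(2, ℤ)) = g' * δ * g⁻¹ := by
    rw [hδ]; group
  have hM : (M : ℤ) ∣ (γ : SL(2, ℤ)) 1 0 := by
    have hmem := γ.2
    rw [Gamma0_mem] at hmem
    exact (ZMod.intCast_zmod_eq_zero_iff_dvd _ M).mp hmem
  have hentry : (γ : SL(2, ℤ)) 1 0 =
      δ 0 0 * (g' 1 0 * g 1 1 - g' 1 1 * g 1 0) - δ 0 1 * g 1 0 * g' 1 0 := by
    rw [hγ]
    simp [Matrix.SpecialLinearGroup.coe_inv, Matrix.adjugate_fin_two, Matrix.mul_apply, Fin.sum_univ_two, h10]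
    rw [← hdiag]
    ring
  obtain ⟨m, hm⟩ := hM
  refine ⟨-(δ 0 0 * δ 0 1), δ 0 0 * m, ?_⟩
  rw [hentry] at hm
  have hsq : δ 0 0 * δ 0 0 = 1 := by rw [← hdiag] at hunit; exact hunit
  linear_combination δ 0 0 * hm - (g' 1 0 * g 1 1 - g' 1 1 * g 1 0) * hsq

/-- The case `γ = 1`: two matrices with the same value `g∞ = g'∞` have related bottom rows. [folklore] -/
theorem cuspRel_of_smul_infty_eq (g g' : SL(2, ℤ))
    (h : (mapGL ℚ g : GL (Fin 2) ℚ) • (OnePoint.infty : OnePoint ℚ) = (mapGL ℚ g' : GL (Fin 2) ℚ) • OnePoint.infty) :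
    ∃ k : ℤ, (M : ℤ) ∣ g' 1 0 * (g 1 1 + k * g 1 0) - g' 1 1 * g 1 0 :=
  cuspRel_of_gamma0_smul_eq M g g' 1 (by rw [Subgroup.coe_one, map_one, one_smul, h])

/-- **Values of invariant functions.**  A `Γ₀(M)`-invariant function on `P¹(ℚ)` takes the same value at `g∞` and
`g'∞` whenever the bottom rows of `g, g'` are related. [folklore] -/
theorem cuspFun_eq_of_cuspRel {K : Type*} (w : OnePoint ℚ → K)
    (hw : ∀ γ : Gamma0 M, ∀ x, w ((mapGL ℚ (γ : SL(2, ℤ)) : GL (Fin 2) ℚ) • x) = w x) (g g' : SL(2, ℤ))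
    (h : ∃ k : ℤ, (M : ℤ) ∣ g' 1 0 * (g 1 1 + k * g 1 0) - g' 1 1 * g 1 0) :
    w ((mapGL ℚ g : GL (Fin 2) ℚ) • OnePoint.infty) = w ((mapGL ℚ g' : GL (Fin 2) ℚ) • OnePoint.infty) := by
  obtain ⟨γ, hγ⟩ := exists_gamma0_smul_eq_of_cuspRel M g g' h
  rw [← hγ, hw]

end Orbit

end Summit.BirchSwinnertonDyer.BirchSwinnertonDyer.Theorems.ManinLocalTwoThree
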